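import Literature.AnabelianGeometry.SemiGraphs.CosetCategories
import Literature.AnabelianGeometry.SemiGraphs.Temperoids
import Literature.AlgebraicGeometry.Frobenioids.QuasiTemperoidConnected
import HarnessLib

/-!
# The small coset category IS `𝓑^temp(Π)⁰`: `CosetCat Π ≌ ConnectedPart (BTemp Π)` for tempered `Π`

Mochizuki, *The geometry of Frobenioids II*, Kyushu J. Math. **62** (2008), §1 Example 1.3 (i), p. 11
[cite: MochizukiFrdII2008, Ex 1.3 (i) p.11]: the connected objects of `𝓑^temp(Π)` are "the set[s] of cosets `Π/Π°`
equipped with [their] natural `Π`-action from the left" (`Π° ⊆ Π` open); Mochizuki, *Semi-graphs of anabelioids*,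
Rmk 3.1.2 p. 33 [cite: MochizukiSemiAnbd2006, Rmk 3.1.2 p.33]: for `Π` tempered, "`Π/H` forms an object of
`𝓑^temp(Π)` if and only if `H` is open".

`CosetCategories.lean` introduced the SMALL model `CosetCat Π` (objects the open subgroups, morphisms the equivariant
maps of coset spaces) of the category of connected objects of `𝓑^temp(Π)` because abc-iut-L5-t2's interface
`GoodLocalFrobenioid.{u}` needs small bases. This file justifies the model against the tree's notion
(`Literature.AnabelianGeometry.SemiGraphs.BTemp`, abc-iut-L3; `ConnectedPart`, abc-iut-L1): for `Π` a tempered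
topological group,
* `CosetCat.toBTemp : CosetCat Π ⥤ BTemp Π`, `U ↦ Π/U` (abc-iut-L3's `BTemp.quotientObj`), FULL and FAITHFUL;
* its values are connected (one orbit; abc-iut-L1's `BTempConnected.isConnectedObj_of_transitive`), whence
  `CosetCat.toConnected : CosetCat Π ⥤ ConnectedPart (BTemp Π)`, full, faithful and ESSENTIALLY SURJECTIVE (a connected
  object is a single orbit — `BTempConnected.exists_ρ_eq_of_isConnectedObj` — hence isomorphic to `Π/Stab(x₀)` with
  `Stab(x₀)` open);
* `CosetCat.equivConnectedPart : CosetCat Π ≌ ConnectedPart (BTemp Π)` — the small model is equivalent to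
  `𝓑^temp(Π)⁰` ("one notion": every statement over `ConnectedPart (BTemp Π)` transports).
Pure category theory over the tree's landed files; nothing of the disputed series is asserted.
-/

namespace Literature.AnabelianGeometry.SemiGraphs

open CategoryTheory Literature.AlgebraicGeometry.Frobenioids
open Literature.AlgebraicGeometry.Frobenioids.QuasiTemperoid

universe u

namespace CosetCat

variable {G : Type u} [Group G] [TopologicalSpace G] [IsTopologicalGroup G] (hG : IsTempered G)

/-- **`CosetCat Π → 𝓑^temp(Π)`, `U ↦ Π/U`** ("`Π/H` forms an object of `𝓑^temp(Π)` iff `H` is open", [SemiAnbd]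
Rmk 3.1.2; abc-iut-L3's `BTemp.quotientObj`), an equivariant map going to itself as a morphism of `Π`-sets.
[cite: MochizukiSemiAnbd2006, Rmk 3.1.2 p.33] -/
def toBTemp : CosetCat G ⥤ BTemp G where
  obj X := BTemp.quotientObj G hG X.sg.toSubgroup X.sg.isOpen
  map f := ObjectProperty.homMk
    { hom := TypeCat.ofHom (Hom.toFun f)
      comm := fun g => by
        apply ConcreteCategory.hom_ext
        intro x
        exact Hom.map_smul f g x }
  map_id X := BTempConnected.hom_ext_apply fun _ => rfl
  map_comp f g := BTempConnected.hom_ext_apply fun _ => rfl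

/-- The underlying function of `toBTemp.map f` is that of `f`. [cite: MochizukiSemiAnbd2006, Rmk 3.1.2 p.33] -/
@[simp] theorem toBTemp_map_apply {X Y : CosetCat G} (f : X ⟶ Y) (x : X.carrier) :
    (((toBTemp hG).map f).hom.hom x : Y.carrier) = Hom.toFun f x := rfl

/-- The action on `toBTemp.obj X = Π/U` is left multiplication. [cite: MochizukiSemiAnbd2006, Rmk 3.1.2 p.33] -/
theorem toBTemp_ρ (X : CosetCat G) (g : G) (x : X.carrier) :
    (((toBTemp hG).obj X).obj.ρ g x : X.carrier) = g • x := rfl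

omit [IsTopologicalGroup G] in
/-- `Π` acts transitively on `Π/U`: every coset is `g · (1·U)`. [cite: MochizukiFrdII2008, Ex 1.3 (i) p.11] -/
theorem exists_smul_one_eq (X : CosetCat G) (r : X.carrier) : ∃ g : G, g • ((1 : G) : X.carrier) = r :=
  QuotientGroup.induction_on r fun a => ⟨a, by rw [MulAction.Quotient.smul_coe, smul_eq_mul, mul_one]⟩

omit [IsTopologicalGroup G] in
/-- `g · (1·U) = 1·U` iff `g ∈ U`. [cite: MochizukiFrdII2008, Ex 1.3 (i) p.11] -/
theorem smul_one_eq_one_iff (X : CosetCat G) (g : G) : g • ((1 : G) : X.carrier) = ((1 : G) : X.carrier) ↔ g ∈ X.sg := by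
  rw [MulAction.Quotient.smul_coe, smul_eq_mul, mul_one, QuotientGroup.eq, mul_one, inv_mem_iff]
  rfl

/-- `toBTemp` is full: a morphism of `Π`-sets `Π/U → Π/V` is an equivariant map. [cite: MochizukiFrdII2008, Ex 1.3 (i) p.11] -/
theorem toBTemp_full : (toBTemp hG).Full where
  map_surjective h :=
    ⟨⟨fun x => h.hom.hom x, fun g x => BTempConnected.hom_ρ h g x⟩, BTempConnected.hom_ext_apply fun _ => rfl⟩

/-- `toBTemp` is faithful. [cite: MochizukiFrdII2008, Ex 1.3 (i) p.11] -/
theorem toBTemp_faithful : (toBTemp hG).Faithful where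
  map_injective h := hom_ext_toFun fun x => congrArg (fun k => k.hom.hom x) h

/-- `Π/U` is a CONNECTED object of `𝓑^temp(Π)` (a single orbit; abc-iut-L1's
`BTempConnected.isConnectedObj_of_transitive`). [cite: MochizukiFrdII2008, Ex 1.3 (i) p.11] -/
theorem isConnectedObj_toBTemp (X : CosetCat G) : IsConnectedObj ((toBTemp hG).obj X) :=
  BTempConnected.isConnectedObj_of_transitive _ ((1 : G) : X.carrier) (exists_smul_one_eq X)

/-- **`CosetCat Π → 𝓑^temp(Π)⁰`** (the lift of `toBTemp` to the full subcategory of connected objects).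
[cite: MochizukiFrdII2008, Ex 1.3 (i) p.11] -/
def toConnected : CosetCat G ⥤ ConnectedPart (BTemp G) :=
  (connectedObjects (BTemp G)).lift (toBTemp hG) (isConnectedObj_toBTemp hG)

/-- `toConnected` is full. [cite: MochizukiFrdII2008, Ex 1.3 (i) p.11] -/
theorem toConnected_full : (toConnected hG).Full where
  map_surjective h := by
    obtain ⟨f, hf⟩ := (toBTemp_full hG).map_surjective h.hom
    exact ⟨f, ObjectProperty.hom_ext _ hf⟩

/-- `toConnected` is faithful. [cite: MochizukiFrdII2008, Ex 1.3 (i) p.11] -/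
theorem toConnected_faithful : (toConnected hG).Faithful where
  map_injective h := (toBTemp_faithful hG).map_injective (congrArg (fun k => k.hom) h)

/-! ### Essential surjectivity: a connected object is `Π/Stab(x₀)` -/

/-- The stabiliser of a point of an object of `𝓑^temp(Π)`, as an OPEN subgroup (open stabilisers are part of the
definition of `𝓑^temp(Π)`). [cite: MochizukiSemiAnbd2006, Rmk 3.1.2 p.33] -/
def stabObj (T : BTemp G) (x₀ : T.obj.V) : CosetCat G :=
  ⟨⟨{ carrier := {g : G | T.obj.ρ g x₀ = x₀}
      mul_mem' := fun {a b} ha hb => by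
        change T.obj.ρ (a * b) x₀ = x₀
        rw [BTempConnected.ρ_mul_apply, hb, ha]
      one_mem' := BTempConnected.ρ_one_apply T x₀
      inv_mem' := fun {a} ha => by
        change T.obj.ρ a⁻¹ x₀ = x₀
        conv_lhs => rw [← ha]
        exact BTempConnected.ρ_inv_apply T a x₀ }, T.property.2 x₀⟩⟩

omit [IsTopologicalGroup G] in
/-- Membership in the stabiliser. [cite: MochizukiSemiAnbd2006, Rmk 3.1.2 p.33] -/
theorem mem_stabObj (T : BTemp G) (x₀ : T.obj.V) (g : G) : g ∈ (stabObj T x₀).sg ↔ T.obj.ρ g x₀ = x₀ := Iff.rfl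

/-- The orbit map `Π/Stab(x₀) → T`, `g ↦ g·x₀`, as a morphism of `𝓑^temp(Π)` (abc-iut-L1's
`exists_hom_of_stabilizer_le`). [cite: MochizukiFrdII2008, Ex 1.3 (i) p.11] -/
theorem exists_orbitHom (T : BTemp G) (x₀ : T.obj.V) :
    ∃ f : (toBTemp hG).obj (stabObj T x₀) ⟶ T, (f.hom.hom ((1 : G) : (stabObj T x₀).carrier) : T.obj.V) = x₀ :=
  BTempConnected.exists_hom_of_stabilizer_le _ (exists_smul_one_eq (stabObj T x₀)) x₀ fun g hg => by
    have hg' : g • ((1 : G) : (stabObj T x₀).carrier) = ((1 : G) : (stabObj T x₀).carrier) := hg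
    exact (mem_stabObj T x₀ g).mp ((smul_one_eq_one_iff _ g).mp hg')

/-- The inverse `T → Π/Stab(x₀)`, `g·x₀ ↦ g·Stab(x₀)`, for `T` CONNECTED (a single orbit).
[cite: MochizukiFrdII2008, Ex 1.3 (i) p.11] -/
theorem exists_orbitInv (T : BTemp G) (hT : IsConnectedObj T) (x₀ : T.obj.V) :
    ∃ f : T ⟶ (toBTemp hG).obj (stabObj T x₀),
      (f.hom.hom x₀ : (stabObj T x₀).carrier) = ((1 : G) : (stabObj T x₀).carrier) :=
  BTempConnected.exists_hom_of_stabilizer_le (T₂ := (toBTemp hG).obj (stabObj T x₀)) x₀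
    (BTempConnected.exists_ρ_eq_of_isConnectedObj T hT x₀) ((1 : G) : (stabObj T x₀).carrier) fun g hg => by
      change g • ((1 : G) : (stabObj T x₀).carrier) = ((1 : G) : (stabObj T x₀).carrier)
      exact (smul_one_eq_one_iff _ g).mpr ((mem_stabObj T x₀ g).mpr hg)

/-- **A connected object of `𝓑^temp(Π)` is isomorphic to `Π/Stab(x₀)`** for any of its points `x₀` ("the set of
cosets `Π/Π°` equipped with its natural `Π`-action", [FrdII] Ex. 1.3 (i)). [cite: MochizukiFrdII2008, Ex 1.3 (i) p.11] -/
theorem nonempty_iso_toBTemp (T : BTemp G) (hT : IsConnectedObj T) (x₀ : T.obj.V) :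
    Nonempty ((toBTemp hG).obj (stabObj T x₀) ≅ T) := by
  obtain ⟨f, hf⟩ := exists_orbitHom hG T x₀
  obtain ⟨f', hf'⟩ := exists_orbitInv hG T hT x₀
  refine ⟨⟨f, f', ?_, ?_⟩⟩
  · refine BTempConnected.hom_eq_of_apply_eq (isConnectedObj_toBTemp hG _) _ _ ((1 : G) : (stabObj T x₀).carrier) ?_
    change (f'.hom.hom (f.hom.hom ((1 : G) : (stabObj T x₀).carrier)) : (stabObj T x₀).carrier) = _
    rw [hf, hf']
    rfl
  · refine BTempConnected.hom_eq_of_apply_eq hT _ _ x₀ ?_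
    change (f.hom.hom (f'.hom.hom x₀) : T.obj.V) = _
    rw [hf', hf]
    rfl

/-- `toConnected` is essentially surjective: every connected object of `𝓑^temp(Π)` is a coset space.
[cite: MochizukiFrdII2008, Ex 1.3 (i) p.11] -/
theorem toConnected_essSurj : (toConnected hG).EssSurj where
  mem_essImage T := by
    obtain ⟨x₀⟩ := BTempConnected.nonempty_of_isConnectedObj T.obj T.property
    obtain ⟨e⟩ := nonempty_iso_toBTemp hG T.obj T.property x₀
    exact ⟨stabObj T.obj x₀, ⟨(connectedObjects (BTemp G)).isoMk e⟩⟩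

/-- `toConnected` is an equivalence of categories. [cite: MochizukiFrdII2008, Ex 1.3 (i) p.11] -/
theorem toConnected_isEquivalence : (toConnected hG).IsEquivalence :=
  { faithful := toConnected_faithful hG, full := toConnected_full hG, essSurj := toConnected_essSurj hG }

/-- **`CosetCat Π ≌ 𝓑^temp(Π)⁰`** for `Π` tempered (in particular profinite, [SemiAnbd] Rmk 3.1.1): the small coset
model of `CosetCategories.lean` IS the tree's category of connected objects of `𝓑^temp(Π)` up to equivalence.
[cite: MochizukiFrdII2008, Ex 1.3 (i) p.11] -/
noncomputable def equivConnectedPart : CosetCat G ≌ ConnectedPart (BTemp G) :=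
  haveI := toConnected_isEquivalence hG
  (toConnected hG).asEquivalence

/-- The equivalence is `toConnected` on objects: `U ↦ Π/U`. [cite: MochizukiFrdII2008, Ex 1.3 (i) p.11] -/
theorem equivConnectedPart_functor : (equivConnectedPart hG).functor = toConnected hG := rfl

end CosetCat

end Literature.AnabelianGeometry.SemiGraphs
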